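import Summits.CriticalPhenomena.CardyFormulaZ2.Theorems.CardyMeckeFlipMeckeRigidityCampbellIntegrand
import Literature.Probability.Percolation.QuadCrossingNoiseBlack

/-!
# Borel indicators on the Schramm–Smirnov space are `L¹`-limits of cylinder functions

Route `Summits/CriticalPhenomena/CardyFormulaZ2/Theses/CardyMeckeFlip`, crux `MeckeRigidity`
(item stmt-CriticalPhenomena-14826), line `registered`, stub `stub_crossingUniqueness` (helper; the
measure-theoretic input of the ergodicity theorem of `…MeckeRigidityErgodic`).

For every finite Borel measure `P` on `ℋ_ℂ = QuadConfig univ` and every Borel set `A`, the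
indicator `1_A` is approximable in `L¹(P)` to any precision by `[0,1]`-valued CYLINDER functions
`S ↦ G {j | Qf j ∈ S}` of finitely many quads (`exists_quadPattern_approx_indicator`; registered
`∀`-form `quadPattern_approx_indicator`).  Proof: Dynkin induction
(`MeasurableSpace.induction_on_inter`) over the `π`-system of finite intersections of crossing
events, which generates the Borel `σ`-field (Schramm–Smirnov Thm. 1.4 (2); tree:
`borel_eq_generateFrom_generatePiSystem_crossedEvent`): its members have indicators that ARE
`{0,1}`-cylinder functions (`exists_quadPattern_eq_indicator_of_generatePiSystem`, appending
families: `setOf_castAdd_mem_pattern_append`, `setOf_natAdd_mem_pattern_append`); complements pass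
to `1 − G`; a countable disjoint union is a vanishing tail `⋃_{i ≥ n} f i` plus finitely many
heads, whose approximants are appended (sums) and clamped back to `[0,1]` (`abs_sub_clamp_le`).
-/

noncomputable section

open MeasureTheory Set Metric Filter Topology
open scoped ENNReal NNReal
open Literature.Probability.Percolation Literature.Probability.Percolation.QuadCrossing

namespace Summit.CriticalPhenomena.CardyFormulaZ2.Theorems.CardyMeckeFlip

/-! ### Cylinder functions: appending families -/

section CylinderAlgebra

variable {D : Set ℂ}

/-- The left block of the crossing pattern of an appended family is the pattern of the left
family. [folklore] -/
@[simp] theorem setOf_castAdd_mem_pattern_append {m m' : ℕ} (Qf : Fin m → Quad D)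
    (Qf' : Fin m' → Quad D) (S : QuadConfig D) :
    {i : Fin m | Fin.castAdd m' i ∈ {k : Fin (m + m') | Fin.append Qf Qf' k ∈ S}} = {i | Qf i ∈ S} := by
  ext i
  simp only [mem_setOf_eq, Fin.append_left]

/-- The right block of the crossing pattern of an appended family is the pattern of the right
family. [folklore] -/
@[simp] theorem setOf_natAdd_mem_pattern_append {m m' : ℕ} (Qf : Fin m → Quad D)
    (Qf' : Fin m' → Quad D) (S : QuadConfig D) :
    {j : Fin m' | Fin.natAdd m j ∈ {k : Fin (m + m') | Fin.append Qf Qf' k ∈ S}} = {j | Qf' j ∈ S} := by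
  ext j
  simp only [mem_setOf_eq, Fin.append_right]

/-- **Finite intersections of crossing events are exact `{0,1}`-cylinder functions**: every member
of the `π`-system generated by the crossing events has an indicator of the form
`S ↦ G {j | Qf j ∈ S}` with `G ∈ {0, 1}`. [folklore] -/
theorem exists_quadPattern_eq_indicator_of_generatePiSystem {t : Set (QuadConfig D)}
    (ht : t ∈ generatePiSystem (range (QuadConfig.crossedEvent (D := D)))) :
    ∃ (m : ℕ) (Qf : Fin m → Quad D) (G : Set (Fin m) → ℝ), (∀ B, G B = 0 ∨ G B = 1) ∧
      ∀ S : QuadConfig D, t.indicator (1 : QuadConfig D → ℝ) S = G {j | Qf j ∈ S} := by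
  induction ht with
  | base h_s =>
    obtain ⟨Q, rfl⟩ := h_s
    refine ⟨1, fun _ => Q, fun B => B.indicator (fun _ => (1 : ℝ)) 0, fun B => ?_, fun S => ?_⟩
    · by_cases h : (0 : Fin 1) ∈ B
      · exact Or.inr (Set.indicator_of_mem h _)
      · exact Or.inl (Set.indicator_of_notMem h _)
    · beta_reduce
      by_cases h : Q ∈ S
      · rw [Set.indicator_of_mem (QuadConfig.mem_crossedEvent.2 h),
          Set.indicator_of_mem (show (0 : Fin 1) ∈ {j : Fin 1 | Q ∈ S} from h)]
        rfl
      · rw [Set.indicator_of_notMem (fun h' => h (QuadConfig.mem_crossedEvent.1 h')),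
          Set.indicator_of_notMem (show (0 : Fin 1) ∉ {j : Fin 1 | Q ∈ S} from h)]
  | inter _ _ _ ihs iht =>
    obtain ⟨m, Qf, G, hG, hs⟩ := ihs
    obtain ⟨m', Qf', G', hG', ht⟩ := iht
    refine ⟨m + m', Fin.append Qf Qf',
      fun B => G {i | Fin.castAdd m' i ∈ B} * G' {j | Fin.natAdd m j ∈ B}, fun B => ?_, fun S => ?_⟩
    · rcases hG {i | Fin.castAdd m' i ∈ B} with h | h <;>
        rcases hG' {j | Fin.natAdd m j ∈ B} with h' | h' <;> simp [h, h']
    · simp only [setOf_castAdd_mem_pattern_append, setOf_natAdd_mem_pattern_append, ← hs S, ← ht S]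
      rename_i s t _ _ _
      by_cases h1 : S ∈ s <;> by_cases h2 : S ∈ t <;> simp [Set.indicator, h1, h2]

end CylinderAlgebra

/-! ### Every Borel indicator is an `L¹`-limit of `[0,1]`-valued cylinder functions -/

/-- Clamping to `[0,1]` does not increase the distance to a point of `[0,1]`. [folklore] -/
theorem abs_sub_clamp_le {t x : ℝ} (ht : 0 ≤ t ∧ t ≤ 1) : |t - max 0 (min 1 x)| ≤ |t - x| := by
  rcases le_total x 0 with hx | hx
  · rw [min_eq_right (hx.trans zero_le_one), max_eq_left hx]
    rw [abs_of_nonneg (by linarith), abs_of_nonneg (by linarith)]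
    linarith
  rcases le_total x 1 with hx1 | hx1
  · rw [min_eq_right hx1, max_eq_right hx]
  · rw [min_eq_left hx1, max_eq_right zero_le_one]
    rw [abs_of_nonpos (by linarith), abs_of_nonpos (by linarith)]
    linarith

/-- **Cylinder approximation of Borel indicators.**  For every finite Borel measure `P` on `ℋ_ℂ`
and every Borel set `A`, the indicator of `A` is approximable in `L¹(P)` by `[0,1]`-valued cylinder
functions `S ↦ G {j | Qf j ∈ S}` of finitely many quads (Dynkin induction over the `π`-system of
finite intersections of crossing events, which generates the Borel `σ`-field — Schramm–Smirnov
Thm. 1.4 (2)). [folklore] -/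
theorem exists_quadPattern_approx_indicator (P : Measure (QuadConfig (univ : Set ℂ)))
    [IsFiniteMeasure P] {A : Set (QuadConfig (univ : Set ℂ))} (hA : MeasurableSet A) :
    ∀ δ : ℝ, 0 < δ → ∃ (m : ℕ) (Qf : Fin m → Quad (univ : Set ℂ)) (G : Set (Fin m) → ℝ),
      (∀ B, 0 ≤ G B ∧ G B ≤ 1) ∧
        ∫ S, |A.indicator (1 : QuadConfig (univ : Set ℂ) → ℝ) S - G {j | Qf j ∈ S}| ∂P ≤ δ := by
  -- integrability bookkeeping used throughout
  have hint : ∀ {m : ℕ} (Qf : Fin m → Quad (univ : Set ℂ)) (G : Set (Fin m) → ℝ)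
      (B : Set (QuadConfig (univ : Set ℂ))), MeasurableSet B →
        Integrable (fun S => B.indicator (1 : QuadConfig (univ : Set ℂ) → ℝ) S - G {j | Qf j ∈ S}) P := by
    intro m Qf G B hB
    obtain ⟨C, -, hC⟩ := exists_forall_abs_le_of_pattern G
    refine Integrable.sub ?_ ?_
    · exact (integrable_const (1 : ℝ)).indicator hB
    · refine Integrable.mono' (integrable_const C) (measurable_comp_quadPattern Qf G).aestronglyMeasurable
        (Eventually.of_forall fun S => ?_)
      rw [Real.norm_eq_abs]
      exact hC _
  refine MeasurableSpace.induction_on_inter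
    (C := fun A _ => ∀ δ : ℝ, 0 < δ → ∃ (m : ℕ) (Qf : Fin m → Quad (univ : Set ℂ))
      (G : Set (Fin m) → ℝ), (∀ B, 0 ≤ G B ∧ G B ≤ 1) ∧
        ∫ S, |A.indicator (1 : QuadConfig (univ : Set ℂ) → ℝ) S - G {j | Qf j ∈ S}| ∂P ≤ δ)
    (borel_eq_generateFrom_generatePiSystem_crossedEvent isOpen_univ univ_nonempty)
    (isPiSystem_generatePiSystem _) ?_ ?_ ?_ ?_ A hA
  · -- ∅
    intro δ hδ
    refine ⟨0, fun j => j.elim0, fun _ => 0, fun _ => ⟨le_rfl, zero_le_one⟩, ?_⟩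
    simp only [Set.indicator_empty, sub_zero, abs_zero, integral_zero]
    exact hδ.le
  · -- finite intersections of crossing events: exact cylinder functions
    intro t ht δ hδ
    obtain ⟨m, Qf, G, hG, heq⟩ := exists_quadPattern_eq_indicator_of_generatePiSystem ht
    refine ⟨m, Qf, G, fun B => ?_, ?_⟩
    · rcases hG B with h | h <;> simp [h]
    · simp only [heq, sub_self, abs_zero, integral_zero]
      exact hδ.le
  · -- complements: `1 - G`
    intro t htm iht δ hδ
    obtain ⟨m, Qf, G, hG, hle⟩ := iht δ hδ
    refine ⟨m, Qf, fun B => 1 - G B, fun B => ⟨by linarith [(hG B).2], by linarith [(hG B).1]⟩, ?_⟩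
    refine le_trans (le_of_eq ?_) hle
    refine integral_congr_ae (ae_of_all _ fun S => ?_)
    simp only [Set.indicator_compl, Pi.sub_apply, Pi.one_apply]
    rw [abs_sub_comm]
    congr 1
    ring
  · -- countable disjoint unions: tail + heads + clamp
    intro f hdisj hfm ihf δ hδ
    -- (a) the tails `T n = ⋃_{i ≥ n} f i` decrease to `∅`
    set T : ℕ → Set (QuadConfig (univ : Set ℂ)) := fun n => ⋃ i, ⋃ (_ : n ≤ i), f i with hT
    have hTm : ∀ n, MeasurableSet (T n) := fun n =>
      MeasurableSet.iUnion fun i => MeasurableSet.iUnion fun _ => hfm i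
    have hTanti : Antitone T := by
      intro n n' hnn' S hS
      simp only [hT, mem_iUnion] at hS ⊢
      obtain ⟨i, hi, hS⟩ := hS
      exact ⟨i, hnn'.trans hi, hS⟩
    have hTempty : ⋂ n, T n = ∅ := by
      ext S
      simp only [mem_iInter, hT, mem_iUnion, mem_empty_iff_false, iff_false, not_forall, not_exists]
      by_contra hall
      push Not at hall
      obtain ⟨i, -, hi⟩ := hall 0
      obtain ⟨j, hj, hj'⟩ := hall (i + 1)
      have hne : i ≠ j := by omega
      exact (Set.disjoint_left.1 (hdisj hne)) hi hj'
    have hTlim : Tendsto (fun n => P (T n)) atTop (𝓝 0) := by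
      have := tendsto_measure_iInter_atTop (μ := P) (fun n => (hTm n).nullMeasurableSet) hTanti
        ⟨0, measure_ne_top P _⟩
      rwa [hTempty, measure_empty] at this
    -- choose `n` with small tail
    have hδ2 : (0 : ℝ≥0∞) < ENNReal.ofReal (δ / 2) := ENNReal.ofReal_pos.2 (by linarith)
    obtain ⟨n, hn⟩ := (ENNReal.tendsto_atTop_zero.1 hTlim) _ hδ2
    have hTn : P.real (T n) ≤ δ / 2 := by
      have := hn n le_rfl
      exact (ENNReal.toReal_le_of_le_ofReal (by linarith) this)
    -- (b) heads: approximate the partial sums `Σ_{i<n'} 1_{f i}` for `n' ≤ n`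
    set η : ℝ := δ / (2 * ((n : ℝ) + 1)) with hη
    have hηpos : 0 < η := by rw [hη]; positivity
    have heads : ∀ n' : ℕ, ∃ (m : ℕ) (Qf : Fin m → Quad (univ : Set ℂ)) (G : Set (Fin m) → ℝ),
        (∀ B, 0 ≤ G B ∧ G B ≤ n') ∧
        Integrable (fun S => (∑ i ∈ Finset.range n', (f i).indicator (1 : QuadConfig (univ : Set ℂ) → ℝ) S) -
          G {j | Qf j ∈ S}) P ∧
        ∫ S, |(∑ i ∈ Finset.range n', (f i).indicator (1 : QuadConfig (univ : Set ℂ) → ℝ) S) -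
          G {j | Qf j ∈ S}| ∂P ≤ n' * η := by
      intro n'
      induction n' with
      | zero =>
        refine ⟨0, fun j => j.elim0, fun _ => 0, fun _ => ⟨le_rfl, by norm_num⟩, ?_, ?_⟩
        · simp only [Finset.range_zero, Finset.sum_empty, sub_zero]
          exact integrable_zero _ _ _
        · simp
      | succ n' ih =>
        obtain ⟨m, Qf, G, hG, hI, hle⟩ := ih
        obtain ⟨m', Qf', G', hG', hle'⟩ := ihf n' η hηpos
        have hI' := hint Qf' G' (f n') (hfm n')
        refine ⟨m + m', Fin.append Qf Qf',
          fun B => G {i | Fin.castAdd m' i ∈ B} + G' {j | Fin.natAdd m j ∈ B}, fun B => ?_, ?_, ?_⟩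
        · constructor
          · exact add_nonneg (hG _).1 (hG' _).1
          · push_cast
            linarith [(hG {i | Fin.castAdd m' i ∈ B}).2, (hG' {j | Fin.natAdd m j ∈ B}).2]
        · have e : (fun S => (∑ i ∈ Finset.range (n' + 1), (f i).indicator (1 : QuadConfig (univ : Set ℂ) → ℝ) S) -
              (G {i | Fin.castAdd m' i ∈ {k | Fin.append Qf Qf' k ∈ S}} +
                G' {j | Fin.natAdd m j ∈ {k | Fin.append Qf Qf' k ∈ S}})) =
              fun S => ((∑ i ∈ Finset.range n', (f i).indicator 1 S) - G {j | Qf j ∈ S}) +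
                ((f n').indicator 1 S - G' {j | Qf' j ∈ S}) := by
            funext S
            rw [setOf_castAdd_mem_pattern_append, setOf_natAdd_mem_pattern_append, Finset.sum_range_succ]
            ring
          rw [e]
          exact hI.add hI'
        · have e : ∀ S, |(∑ i ∈ Finset.range (n' + 1), (f i).indicator (1 : QuadConfig (univ : Set ℂ) → ℝ) S) -
              (G {i | Fin.castAdd m' i ∈ {k | Fin.append Qf Qf' k ∈ S}} +
                G' {j | Fin.natAdd m j ∈ {k | Fin.append Qf Qf' k ∈ S}})| ≤
              |(∑ i ∈ Finset.range n', (f i).indicator (1 : QuadConfig (univ : Set ℂ) → ℝ) S) - G {j | Qf j ∈ S}| +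
                |(f n').indicator (1 : QuadConfig (univ : Set ℂ) → ℝ) S - G' {j | Qf' j ∈ S}| := by
            intro S
            rw [setOf_castAdd_mem_pattern_append, setOf_natAdd_mem_pattern_append, Finset.sum_range_succ]
            have : (∑ i ∈ Finset.range n', (f i).indicator (1 : QuadConfig (univ : Set ℂ) → ℝ) S) +
                (f n').indicator 1 S - (G {j | Qf j ∈ S} + G' {j | Qf' j ∈ S}) =
                ((∑ i ∈ Finset.range n', (f i).indicator (1 : QuadConfig (univ : Set ℂ) → ℝ) S) - G {j | Qf j ∈ S}) +
                  ((f n').indicator 1 S - G' {j | Qf' j ∈ S}) := by ring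
            rw [this]
            exact abs_add_le _ _
          calc ∫ S, |(∑ i ∈ Finset.range (n' + 1), (f i).indicator (1 : QuadConfig (univ : Set ℂ) → ℝ) S) -
                (G {i | Fin.castAdd m' i ∈ {k | Fin.append Qf Qf' k ∈ S}} +
                  G' {j | Fin.natAdd m j ∈ {k | Fin.append Qf Qf' k ∈ S}})| ∂P
              ≤ ∫ S, (|(∑ i ∈ Finset.range n', (f i).indicator (1 : QuadConfig (univ : Set ℂ) → ℝ) S) - G {j | Qf j ∈ S}| +
                  |(f n').indicator (1 : QuadConfig (univ : Set ℂ) → ℝ) S - G' {j | Qf' j ∈ S}|) ∂P :=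
                integral_mono_of_nonneg (ae_of_all _ fun S => abs_nonneg _) (hI.abs.add hI'.abs)
                  (ae_of_all _ e)
            _ = (∫ S, |(∑ i ∈ Finset.range n', (f i).indicator (1 : QuadConfig (univ : Set ℂ) → ℝ) S) - G {j | Qf j ∈ S}| ∂P) +
                  ∫ S, |(f n').indicator (1 : QuadConfig (univ : Set ℂ) → ℝ) S - G' {j | Qf' j ∈ S}| ∂P :=
                integral_add hI.abs hI'.abs
            _ ≤ n' * η + η := add_le_add hle hle'
            _ = (n' + 1 : ℕ) * η := by push_cast; ring
    -- (c) the approximant: heads up to `n`, clamped to `[0,1]`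
    obtain ⟨m, Qf, G, hG, hI, hle⟩ := heads n
    refine ⟨m, Qf, fun B => max 0 (min 1 (G B)), fun B => ⟨le_max_left _ _,
      max_le zero_le_one (min_le_left _ _)⟩, ?_⟩
    -- pointwise: `|1_{⋃ f} - clamp c| ≤ 1_{T n} + |Σ_{i<n} 1_{f i} - c|`
    have hsplit : ∀ S, (⋃ i, f i).indicator (1 : QuadConfig (univ : Set ℂ) → ℝ) S =
        (T n).indicator 1 S + ∑ i ∈ Finset.range n, (f i).indicator 1 S := by
      intro S
      by_cases hS : S ∈ ⋃ i, f i
      · rw [Set.indicator_of_mem hS]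
        obtain ⟨i, hi⟩ := mem_iUnion.1 hS
        have hothers : ∀ j, j ≠ i → (f j).indicator (1 : QuadConfig (univ : Set ℂ) → ℝ) S = 0 :=
          fun j hj => Set.indicator_of_notMem (fun hj' => (Set.disjoint_left.1 (hdisj hj)) hj' hi) _
        by_cases hin : n ≤ i
        · have hT' : S ∈ T n := by simp only [hT, mem_iUnion]; exact ⟨i, hin, hi⟩
          rw [Set.indicator_of_mem hT', Finset.sum_eq_zero fun j hj => hothers j ?_]
          · simp
          · have := Finset.mem_range.1 hj; omega
        · push Not at hin
          have hT' : S ∉ T n := by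
            simp only [hT, mem_iUnion, not_exists]
            intro j hj hj'
            exact (Set.disjoint_left.1 (hdisj (show j ≠ i by omega))) hj' hi
          rw [Set.indicator_of_notMem hT', Finset.sum_eq_single i (fun j _ hj => hothers j hj)
            (fun h => (h (Finset.mem_range.2 hin)).elim), Set.indicator_of_mem hi]
          simp
      · rw [Set.indicator_of_notMem hS]
        have hT' : S ∉ T n := fun h => hS (by
          simp only [hT, mem_iUnion] at h
          obtain ⟨i, -, hi⟩ := h
          exact mem_iUnion.2 ⟨i, hi⟩)
        rw [Set.indicator_of_notMem hT', Finset.sum_eq_zero fun j _ =>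
          Set.indicator_of_notMem (fun hj => hS (mem_iUnion.2 ⟨j, hj⟩)) _]
        simp
    have hsum_mem : ∀ S, 0 ≤ ∑ i ∈ Finset.range n, (f i).indicator (1 : QuadConfig (univ : Set ℂ) → ℝ) S ∧
        ∑ i ∈ Finset.range n, (f i).indicator (1 : QuadConfig (univ : Set ℂ) → ℝ) S ≤ 1 := by
      intro S
      have h1 := hsplit S
      have hU : (⋃ i, f i).indicator (1 : QuadConfig (univ : Set ℂ) → ℝ) S ≤ 1 :=
        Set.indicator_le_self' (fun _ _ => zero_le_one) S
      have hTge : 0 ≤ (T n).indicator (1 : QuadConfig (univ : Set ℂ) → ℝ) S :=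
        Set.indicator_nonneg (fun _ _ => zero_le_one) S
      refine ⟨Finset.sum_nonneg fun i _ => Set.indicator_nonneg (fun _ _ => zero_le_one) S, ?_⟩
      linarith
    have hpt : ∀ S, |(⋃ i, f i).indicator (1 : QuadConfig (univ : Set ℂ) → ℝ) S - max 0 (min 1 (G {j | Qf j ∈ S}))| ≤
        (T n).indicator (1 : QuadConfig (univ : Set ℂ) → ℝ) S +
          |(∑ i ∈ Finset.range n, (f i).indicator (1 : QuadConfig (univ : Set ℂ) → ℝ) S) - G {j | Qf j ∈ S}| := by
      intro S
      rw [hsplit S]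
      have hc := abs_sub_clamp_le (x := G {j | Qf j ∈ S}) (hsum_mem S)
      have hTge : 0 ≤ (T n).indicator (1 : QuadConfig (univ : Set ℂ) → ℝ) S :=
        Set.indicator_nonneg (fun _ _ => zero_le_one) S
      calc |(T n).indicator (1 : QuadConfig (univ : Set ℂ) → ℝ) S +
              ∑ i ∈ Finset.range n, (f i).indicator 1 S - max 0 (min 1 (G {j | Qf j ∈ S}))|
          ≤ |(T n).indicator (1 : QuadConfig (univ : Set ℂ) → ℝ) S| +
              |∑ i ∈ Finset.range n, (f i).indicator (1 : QuadConfig (univ : Set ℂ) → ℝ) S - max 0 (min 1 (G {j | Qf j ∈ S}))| := by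
            rw [add_sub_assoc]; exact abs_add_le _ _
        _ ≤ (T n).indicator (1 : QuadConfig (univ : Set ℂ) → ℝ) S +
              |(∑ i ∈ Finset.range n, (f i).indicator (1 : QuadConfig (univ : Set ℂ) → ℝ) S) - G {j | Qf j ∈ S}| := by
            rw [abs_of_nonneg hTge]; linarith [hc]
    have hIT : Integrable (fun S => (T n).indicator (1 : QuadConfig (univ : Set ℂ) → ℝ) S) P :=
      (integrable_const (1 : ℝ)).indicator (hTm n)
    calc ∫ S, |(⋃ i, f i).indicator (1 : QuadConfig (univ : Set ℂ) → ℝ) S - max 0 (min 1 (G {j | Qf j ∈ S}))| ∂P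
        ≤ ∫ S, ((T n).indicator (1 : QuadConfig (univ : Set ℂ) → ℝ) S +
            |(∑ i ∈ Finset.range n, (f i).indicator (1 : QuadConfig (univ : Set ℂ) → ℝ) S) - G {j | Qf j ∈ S}|) ∂P :=
          integral_mono_of_nonneg (ae_of_all _ fun S => abs_nonneg _) (hIT.add hI.abs) (ae_of_all _ hpt)
      _ = P.real (T n) + ∫ S, |(∑ i ∈ Finset.range n, (f i).indicator (1 : QuadConfig (univ : Set ℂ) → ℝ) S) - G {j | Qf j ∈ S}| ∂P := by
          rw [integral_add hIT hI.abs, integral_indicator_one (hTm n)]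
      _ ≤ δ / 2 + n * η := add_le_add hTn hle
      _ ≤ δ := by
          rw [hη]
          have hn1 : (n : ℝ) / ((n : ℝ) + 1) ≤ 1 := by
            rw [div_le_one (by positivity)]; linarith
          have : (n : ℝ) * (δ / (2 * ((n : ℝ) + 1))) = δ / 2 * ((n : ℝ) / ((n : ℝ) + 1)) := by
            field_simp
          rw [this]
          nlinarith


/-- **Registered form** (sub-goal `quadPattern_approx_indicator` of item
stmt-CriticalPhenomena-14826): Borel indicators on `ℋ_ℂ` are `L¹`-approximable by `[0,1]`-valued
cylinder functions, for every finite Borel measure. [folklore] -/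
theorem quadPattern_approx_indicator : ∀ (P : Measure (QuadConfig (Set.univ : Set ℂ))), IsFiniteMeasure P → ∀ (A : Set (QuadConfig (Set.univ : Set ℂ))), MeasurableSet A → ∀ δ : ℝ, 0 < δ → ∃ (m : ℕ) (Qf : Fin m → Quad (Set.univ : Set ℂ)) (G : Set (Fin m) → ℝ), (∀ B, 0 ≤ G B ∧ G B ≤ 1) ∧ ∫ S, |A.indicator (1 : QuadConfig (Set.univ : Set ℂ) → ℝ) S - G {j | Qf j ∈ S}| ∂P ≤ δ := by
  intro P hP A hA δ hδ
  exact exists_quadPattern_approx_indicator P hA δ hδ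

end Summit.CriticalPhenomena.CardyFormulaZ2.Theorems.CardyMeckeFlip

end
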